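import Summits.HodgeConjecture.HodgeConjecture.Theses.HeckePrymWeil

/-!
# Route HeckePrymWeil — `EightfoldDescentGlue` (item stmt-HodgeConjecture-14751)

The glue of the split of the crux `WeilSixfoldsSqrtMinus7` (D-0019 glued split):

`HyperbolicEightfoldsSqrtMinus7 → AimedDescending → WeilSixfoldsSqrtMinus7`.

Pure logic.  `AimedDescending` says: for `p ≡ 3 (4)` prime, `p ≥ 7`, `n ≥ 1`, IF the Hodge–Weil
classes are algebraic on every SPLIT (hyperbolic for the `K`-symmetrised hyperplane class)
`ℚ(√-p)`-Weil abelian variety of dimension `2 (n + 1)`, THEN they are algebraic on every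
`ℚ(√-p)`-Weil abelian variety of dimension `2 n`.  Instantiate it at `(p, n) = (7, 3)`: its
split-rung hypothesis at `m = n + 1 = 4` is `HyperbolicEightfoldsSqrtMinus7` verbatim up to the
definitional equalities `2 * (3 + 1) = 8`, `((7 : ℕ) : ℤ) = 7`, `((7 : ℕ) : ℂ) = 7`,
`((7 : ℕ) : ℝ) = 7`, and its conclusion at `n = 3` is `WeilSixfoldsSqrtMinus7` up to `2 * 3 = 6`.
All these are closed by `rfl` (numerals in `ℤ`, `ℝ`, `ℂ` are `Nat.cast` of the `ℕ` numeral,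
`Nat.cast_ofNat` is `rfl`), so the instantiated hypotheses are supplied by unification.

Sources: Markman2025SurveySecant §11.5 Step 2; Schoen1998HodgeWeilAddendum §10;
vanGeemen1994HodgeAV 5.2 (for the mathematics inside `AimedDescending`; none is used here).
-/

namespace Summit.HodgeConjecture.HodgeConjecture.Theorems

open Summit.HodgeConjecture.HodgeConjecture.Theses.HeckePrymWeil

/-- **Eightfold descent glue** for `K = ℚ(√-7)`: the split `ℚ(√-7)`-Weil EIGHTFOLD statement
`HyperbolicEightfoldsSqrtMinus7` and the aimed component descent `AimedDescending` (at
`(p, n) = (7, 3)`) give `WeilSixfoldsSqrtMinus7` — the Hodge–Weil classes of every `ℚ(√-7)`-Weil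
abelian sixfold, of every discriminant, are algebraic.  Pure instantiation: `7` is prime,
`7 % 4 = 3`, `7 ≤ 7`, `1 ≤ 3`, and the two rung predicates agree definitionally. -/
theorem weilSixfoldsSqrtMinus7_of_hyperbolicEightfolds_of_aimedDescending
    (h8 : HyperbolicEightfoldsSqrtMinus7) (hAD : AimedDescending) : WeilSixfoldsSqrtMinus7 := by
  unfold WeilSixfoldsSqrtMinus7
  unfold HyperbolicEightfoldsSqrtMinus7 at h8
  unfold AimedDescending at hAD
  intro A φ hdim hφ c hc hH hW
  refine hAD 7 (by norm_num) (by norm_num) le_rfl 3 (by norm_num) ?_ A φ hdim hφ c hc hH hW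
  intro m hm A' φ' hdim' hφ' e a ha ha0 hhyp c' hc' hH' hW'
  subst hm
  exact h8 A' φ' hdim' hφ' e a ha ha0 hhyp c' hc' hH' hW'

/-- **Item stmt-HodgeConjecture-14751 (`EightfoldDescentGlue`) — closing theorem**, typed
literally as the route declaration
`EightfoldDescentGlue : HyperbolicEightfoldsSqrtMinus7 → AimedDescending → WeilSixfoldsSqrtMinus7`:
the split `ℚ(√-7)`-Weil eightfold crux and the aimed component descent at `(p, n) = (7, 3)` give
every `ℚ(√-7)` sixfold discriminant. -/
theorem eightfoldDescentGlue_proof : EightfoldDescentGlue := by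
  unfold EightfoldDescentGlue
  exact weilSixfoldsSqrtMinus7_of_hyperbolicEightfolds_of_aimedDescending

end Summit.HodgeConjecture.HodgeConjecture.Theorems
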